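import Summits.NavierStokesRegularity.NavierStokesRegularity.Theses.FlatSwirlGauge

/-!
# Route FlatSwirlGauge — `Assembly` (item stmt-NavierStokesRegularity-1258)

Pure logic: the route statements of `FlatSwirlGauge`, in the antecedent order

  `FlatGaugeAtSingularity → CriticalSwirlRegularity → LocalBoundedExtends → NoBlowupToClay →
   NavierStokesRegularity`,

imply Clay (A). This is, hypothesis for hypothesis, the route's deciding theorem
`Summit.NavierStokesRegularity.NavierStokesRegularity.Theses.FlatSwirlGauge.closes`; the proof
below is self-contained (it does not invoke `closes`), so that it depends only on the item
definitions.

Argument. `NoBlowupToClay` reduces `NavierStokesRegularity` to: every finite-energy (Leray–Hopf)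
classical solution on `ℝ³ × [0,T)` from a rapidly decaying datum extends smoothly past `T`.
`LocalBoundedExtends` reduces that extension to boundedness of `u` on a backward cylinder
`(T - r², T) × B_r(x₀)` (times `t ≥ 0`) at every `x₀`. At each `x₀`, either such a bound holds, or
`FlatGaugeAtSingularity` supplies a flat swirl gauge on some backward cylinder at `(T, x₀)` and
`CriticalSwirlRegularity` turns it into the bound. Nothing here is new mathematics; the open
content lives in the two cruxes and the support `LocalBoundedExtends`.
-/

namespace Summit.NavierStokesRegularity.NavierStokesRegularity.Theorems

open Summit.NavierStokesRegularity.NavierStokesRegularity.Theses.FlatSwirlGauge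

/-- **Assembly** (item stmt-NavierStokesRegularity-1258, route FlatSwirlGauge):
`FlatGaugeAtSingularity → CriticalSwirlRegularity → LocalBoundedExtends → NoBlowupToClay →
NavierStokesRegularity` — pure logic: `NoBlowupToClay` reduces Clay (A) to continuation past
every `T`; `LocalBoundedExtends` reduces continuation to boundedness on a backward cylinder at
every point `x₀`; there, either `u` is already bounded, or `FlatGaugeAtSingularity` gives a flat
swirl gauge and `CriticalSwirlRegularity` gives the bound. [folklore] -/
theorem flatSwirlGauge_assembly_proof :
    Summit.NavierStokesRegularity.NavierStokesRegularity.Theses.FlatSwirlGauge.Assembly := by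
  unfold Assembly
  intro hFG hCSR hLBE hClay
  refine hClay ?_
  intro ν T hν hT u p hcl hLH hdec
  refine hLBE ν T hν hT u p hcl hLH hdec ?_
  intro x₀
  by_cases hb : (∃ r : ℝ, 0 < r ∧ ∃ K : ℝ, ∀ t ∈ Set.Ioo (T - r ^ 2) T, 0 ≤ t →
      ∀ x ∈ Metric.ball x₀ r, ‖u t x‖ ≤ K)
  · exact hb
  · exact hCSR ν T hν hT u p hcl hLH hdec x₀ (hFG ν T hν hT u p hcl hLH hdec x₀ hb)

end Summit.NavierStokesRegularity.NavierStokesRegularity.Theorems
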